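import Summits.QuantumFields.YangMills.Theses.IsotropyFromPowerCounting
import Summits.QuantumFields.YangMills.Theorems.SoftKernelBoostCovariance.Negative.TieLoadBearing

/-!
# `CurvatureSandwichBound` (Σ) — negative-side support I: the crux unbundled; vacuum-only OS spaces satisfy
the rows; the junk witness of the sibling cruxes does NOT bite the model-blind core

Support file for crux `stmt-QuantumFields-18372` (`IsotropyFromPowerCounting.CurvatureSandwichBound`, the
transversely filtered heat-sandwich bound with one power of slack, `μ < 4`), extracted from the standing
disprover's work file `Cruxes/CurvatureSandwichBound/Disproof.lean`.  Tree objects only; nothing is posited.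

* `SandwichBound S₁ h μ C`, `SandwichRows S₁`, `IsQuarterTurnFrame R` and `curvatureSandwichBound_iff`
  (definitional): the crux is `∀ G …, W1 r sch S₁ → EightFrameRP S₁ → PlanarCone S₁ → SoftKernel S₁ →
  SandwichRows S₁ ∧ ∀ R, IsQuarterTurnFrame R → SandwichRows (S₁ ∘ R)` — its hypotheses are EXACTLY those of
  `MirrorModularBoosts.SoftKernelBoostCovariance` (B′, stmt-14999), so the sibling's non-vacuity
  (`hypotheses_vac_soft`) and tie-pinning analysis apply verbatim.
* `norm_fieldVec_sq`: `‖Ψ_F‖² = Re 𝔖_{2n}(θF* ⊗ F)` — the rows read `S₁` on `⁰𝒮` only, and `h` (a `Prop`) carries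
  no data: there is no junk freedom in the reconstruction.
* `sandwichRows_of_pairing_eq_zero`: a family all of whose positive-degree OS pairings `𝔖_{2n}(θF* ⊗ F)` vanish
  (a VACUUM-ONLY OS space) satisfies the rows with `μ = 0`, `C = 0`.  Instances: the vacuum family in every frame
  (`sandwichRows_vac_pullback`), the junk family of `NPointIsotropy.Negative` in every planar frame
  (`sandwichRows_junk_frame`, in particular the identity and the quarter-turn frames).
* `hypotheses_and_rows_vac`: NON-VACUITY AND CONSISTENCY — for every `G`, `r` the zero scheme and the vacuum
  family meet `W₁`, the eight frames, the cone, the soft kernel AND both rows of the conclusion.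
* `SandwichModelBlind`, `curvatureSandwichBound_of_modelBlind`, `modelBlind_conclusion_junk`: the model-blind core
  (every clause about `S₁` alone).  UNLIKE the sibling cruxes B, B′, T, NPointIsotropy — whose model-blind cores
  the junk family refutes in Lean — the junk family SATISFIES the conclusion of Σ (all its positive-degree field
  vectors are `0`), so it is no witness against `SandwichModelBlind`; no tree family is (see the work file).
-/

noncomputable section

namespace Summit.QuantumFields.YangMills.Theorems.CurvatureSandwichBound.Negative

open scoped BigOperators SchwartzMap ComplexConjugate InnerProductSpace
open MeasureTheory Filter Topology Complex
open Literature.MathematicalPhysics.QuantumLattice Literature.MathematicalPhysics.AQFT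
  Literature.MathematicalPhysics.QuantumFieldTheory
open Summit.QuantumFields.YangMills.Theorems.NPointIsotropy.Negative
open Summit.QuantumFields.YangMills.Theorems.CurvatureBoostCovariance.Negative
  (OSPackage Translations Hypercubic EightFrameRP PlanarCone Tie Gaps W1 vac vac_of_ne_zero pullback_vac
    hypotheses_vac)
open Summit.QuantumFields.YangMills.Theorems.SoftKernelBoostCovariance.Negative
  (SoftKernel softKernel_vac softKernel_junk planarCone_junk hypotheses_vac_soft)

/-! ## §0 The rows; the crux unbundled -/

/-- **One row-block of the conclusion** for a family `S₁`, its `e₀`-reconstruction `h`, an exponent `μ` and a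
constant `C` (verbatim the inner block of the crux; = the registered `stub_sandwichBound` shape of crux 14999's
line): `‖Ψ_{f₁ ⊗ W_{(2u+v)e₀}}‖ ≤ C·Mg·(Mh+Mh')·(u^{-μ}+v^{-μ})·‖Ψ_W‖` for insertions `f₁ = g(x⁰,x¹) hh(x²,x³)`
with times in `[u, 2u]`, `∫|g| ≤ Mg`, `∫|hh| ≤ Mh`, `|hh| ≤ Mh'`, in front of every time-ordered `W`. -/
def SandwichBound (S₁ : SchwingerFamily E4) (h : OSReconstructionNoE1 S₁.toLabelled) (μ C : ℝ) : Prop :=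
  ∀ (u v : ℝ), 0 < u → 0 < v → u ≤ 1 → v ≤ 1 →
  ∀ (f₁ : SchwartzMap (Fin 1 → E4) ℂ) (g hh : ℝ × ℝ → ℂ) (Mg Mh Mh' : ℝ),
    (∀ x : Fin 1 → E4, f₁ x = g (x 0 0, x 0 1) * hh (x 0 2, x 0 3)) →
    (∀ p : ℝ × ℝ, g p ≠ 0 → u ≤ p.1 ∧ p.1 ≤ 2 * u) →
    MeasureTheory.Integrable g → (∫ p, ‖g p‖) ≤ Mg →
    MeasureTheory.Integrable hh → (∫ p, ‖hh p‖) ≤ Mh → (∀ p, ‖hh p‖ ≤ Mh') →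
  ∀ (n : ℕ) (W : SchwartzMap (Fin n → E4) ℂ) (hW : IsTimeOrdered W)
    (hFW : IsTimeOrdered
      (SchwartzMap.appendTensor f₁ (translateMulti ((2 * u + v) • EuclideanSpace.single 0 1) W))),
    ‖h.fieldVec (1 + n) (fun _ => ())
        (SchwartzMap.appendTensor f₁ (translateMulti ((2 * u + v) • EuclideanSpace.single 0 1) W)) hFW‖ ≤
      C * Mg * (Mh + Mh') * (u ^ (-μ) + v ^ (-μ)) * ‖h.fieldVec n (fun _ => ()) W hW‖

/-- **The rows of a family**: for every `e₀`-reconstruction there are `μ < 4` and `C` with the sandwich bound. -/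
def SandwichRows (S₁ : SchwingerFamily E4) : Prop :=
  ∀ (h : OSReconstructionNoE1 S₁.toLabelled), ∃ μ C : ℝ, μ < 4 ∧ SandwichBound S₁ h μ C

/-- **The quarter-turn frame** of the `(x₀,x₁)`-plane, named by its coordinates as in the crux
(`= planeRot 0 (π/4)` of the Literature). -/
def IsQuarterTurnFrame (R : E4 ≃ₗᵢ[ℝ] E4) : Prop :=
  ∀ x : E4, R x 0 = Real.cos (Real.pi / 4) * x 0 + Real.sin (Real.pi / 4) * x 1 ∧
    R x 1 = -Real.sin (Real.pi / 4) * x 0 + Real.cos (Real.pi / 4) * x 1 ∧ R x 2 = x 2 ∧ R x 3 = x 3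

/-- **§0a. The crux, unbundled** (definitional). -/
theorem curvatureSandwichBound_iff :
    Summit.QuantumFields.YangMills.Theses.IsotropyFromPowerCounting.CurvatureSandwichBound ↔
      ∀ (G : Type) [Group G] [TopologicalSpace G] [IsTopologicalGroup G] [CompactSpace G]
        [MeasurableSpace G] [BorelSpace G], IsCompactSimpleLieGroup G →
        ∀ (r : LatticeRep G) (sch : SpeciesScheme (YMSpecies G)) (S₁ : SchwingerFamily E4),
          W1 r sch S₁ → EightFrameRP S₁ → PlanarCone S₁ → SoftKernel S₁ →
            SandwichRows S₁ ∧
              ∀ R : E4 ≃ₗᵢ[ℝ] E4, IsQuarterTurnFrame R → SandwichRows (fun n => (S₁ n).comp (linActMulti R)) :=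
  Iff.rfl

/-- The quarter-turn frame tilts the time axis inside the `(e₀,e₁)`-plane: `R e₀ = cos(π/4) e₀ − sin(π/4) e₁`. -/
theorem IsQuarterTurnFrame.apply_single_zero {R : E4 ≃ₗᵢ[ℝ] E4} (hR : IsQuarterTurnFrame R) :
    R (EuclideanSpace.single 0 1) =
      Real.cos (Real.pi / 4) • EuclideanSpace.single 0 1 + (-Real.sin (Real.pi / 4)) • EuclideanSpace.single 1 1 := by
  obtain ⟨h0, h1, h2, h3⟩ := hR (EuclideanSpace.single 0 1)
  ext i
  fin_cases i
  · simpa using h0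
  · simpa using h1
  · simpa using h2
  · simpa using h3

/-! ## §1 The rows read `S₁` on `⁰𝒮` only; vacuum-only OS spaces satisfy them -/

/-- **`‖Ψ_F‖² = Re 𝔖_{2n}(θF* ⊗ F)`** for the `e₀`-reconstruction of a one-species family: the norms in the rows are
values of `S₁` on off-diagonal test functions; `h` carries no data. -/
theorem norm_fieldVec_sq {S₁ : SchwingerFamily E4} (h : OSReconstructionNoE1 S₁.toLabelled) {n : ℕ}
    (F : 𝓢((Fin n → E4), ℂ)) (hF : IsTimeOrdered F) :
    ‖h.fieldVec n (fun _ => ()) F hF‖ ^ 2 = (S₁ (n + n) ((osAdjoint F).appendTensor F)).re := by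
  have h1 := inner_self_eq_norm_sq (𝕜 := ℂ) (h.fieldVec n (fun _ => ()) F hF)
  rw [h.inner_fieldVec_fieldVec (fun _ => ()) (fun _ => ()) hF hF (isAppendTensorOf_appendTensor (osAdjoint F) F)]
    at h1
  rw [← h1]
  rfl

/-- A field vector whose OS pairing vanishes is `0`. -/
theorem fieldVec_eq_zero_of_pairing_eq_zero {S₁ : SchwingerFamily E4} (h : OSReconstructionNoE1 S₁.toLabelled)
    {n : ℕ} (F : 𝓢((Fin n → E4), ℂ)) (hF : IsTimeOrdered F)
    (h0 : S₁ (n + n) ((osAdjoint F).appendTensor F) = 0) : h.fieldVec n (fun _ => ()) F hF = 0 := by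
  have h2 := norm_fieldVec_sq h F hF
  rw [h0, Complex.zero_re] at h2
  exact norm_eq_zero.1 (pow_eq_zero_iff two_ne_zero |>.1 h2)

/-- **Vacuum-only OS spaces satisfy the rows** with `μ = 0`, `C = 0`: if every positive-degree pairing
`𝔖_{2n}(θF* ⊗ F)` (`F` time-ordered, `n ≥ 1`) vanishes, every left-hand side of the rows is `‖0‖`. -/
theorem sandwichBound_of_pairing_eq_zero {S₁ : SchwingerFamily E4} (h : OSReconstructionNoE1 S₁.toLabelled)
    (h0 : ∀ n : ℕ, n ≠ 0 → ∀ F : 𝓢((Fin n → E4), ℂ), IsTimeOrdered F →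
      S₁ (n + n) ((osAdjoint F).appendTensor F) = 0) :
    SandwichBound S₁ h 0 0 := by
  intro u v _ _ _ _ f₁ g hh Mg Mh Mh' _ _ _ _ _ _ _ n W hW hFW
  rw [fieldVec_eq_zero_of_pairing_eq_zero h _ hFW (h0 (1 + n) (by omega) _ hFW)]
  simp

/-- The same, packaged as the rows. -/
theorem sandwichRows_of_pairing_eq_zero {S₁ : SchwingerFamily E4}
    (h0 : ∀ n : ℕ, n ≠ 0 → ∀ F : 𝓢((Fin n → E4), ℂ), IsTimeOrdered F →
      S₁ (n + n) ((osAdjoint F).appendTensor F) = 0) :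
    SandwichRows S₁ :=
  fun h => ⟨0, 0, by norm_num, sandwichBound_of_pairing_eq_zero h h0⟩

/-! ## §2 The vacuum family: non-vacuity and consistency of the whole crux -/

/-- The vacuum family satisfies the rows (`μ = 0`, `C = 0`). -/
theorem sandwichRows_vac : SandwichRows vac :=
  sandwichRows_of_pairing_eq_zero fun n hn F _ => by rw [vac_of_ne_zero (by omega)]; rfl

/-- … in EVERY frame (the pull-back of the vacuum family by any linear isometry is the vacuum family). -/
theorem sandwichRows_vac_pullback (R : E4 ≃ₗᵢ[ℝ] E4) : SandwichRows (fun n => (vac n).comp (linActMulti R)) := by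
  rw [pullback_vac]
  exact sandwichRows_vac

section NonVacuity

variable {G : Type} [Group G] [TopologicalSpace G] [IsTopologicalGroup G] [CompactSpace G]
  [MeasurableSpace G] [BorelSpace G]

/-- **§2. NON-VACUITY AND CONSISTENCY.**  For EVERY compact group `G` and EVERY lattice representation `r`, the zero
scheme and the vacuum family satisfy `W₁`, the eight-frame RP, the planar cone, the soft kernel (`K = 0`) AND both
rows of the conclusion (the second for every linear isometry, in particular the quarter-turn frame): the hypotheses
of the crux are jointly satisfiable, and the zero scheme (the only `c ≡ 0` slice) is no counterexample. -/
theorem hypotheses_and_rows_vac (r : LatticeRep G) :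
    W1 r (SpeciesScheme.zero _) vac ∧ EightFrameRP vac ∧ PlanarCone vac ∧ SoftKernel vac ∧ SandwichRows vac ∧
      ∀ R : E4 ≃ₗᵢ[ℝ] E4, SandwichRows (fun n => (vac n).comp (linActMulti R)) := by
  obtain ⟨hW, h8, hC, hK, -⟩ := hypotheses_vac_soft r
  exact ⟨hW, h8, hC, hK, sandwichRows_vac, sandwichRows_vac_pullback⟩

end NonVacuity

/-! ## §3 The junk family satisfies the rows in every planar frame -/

/-- **The junk family pulled back by ANY frame `R` with `R e₀ ∈ span(e₀,e₁)` satisfies the rows** (`μ = 0`,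
`C = 0`): `J` kills every `R·(θF* ⊗ F)` with `F` time-ordered (`junk_eq_zero_of_vanish` with `w = R e₀`). -/
theorem sandwichRows_junk_frame (R : E4 ≃ₗᵢ[ℝ] E4) (a b : ℝ)
    (hR : R (EuclideanSpace.single 0 1) = a • EuclideanSpace.single 0 1 + b • EuclideanSpace.single 1 1) :
    SandwichRows (fun n => (junk n).comp (linActMulti R)) := by
  refine sandwichRows_of_pairing_eq_zero fun n hn F hF => ?_
  show junk (n + n) (linActMulti R ((osAdjoint F).appendTensor F)) = 0
  refine junk_eq_zero_of_vanish (by omega) _ (R (EuclideanSpace.single 0 1)) (planar_hw R a b hR) ?_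
  intro z hz
  rw [linActMulti_apply]
  apply append_apply_eq_zero (timeSep_of_isTimeOrdered hF) (timeSep_of_isTimeOrdered hF)
    (isAppendTensorOf_appendTensor (osAdjoint F) F)
  obtain ⟨p, q, hpq, hpq'⟩ := hz
  exact ⟨p, q, hpq, by rw [symm_apply_zero, symm_apply_zero, hpq']⟩

/-- The junk family itself satisfies the rows. -/
theorem sandwichRows_junk : SandwichRows junk := by
  have h := sandwichRows_junk_frame (LinearIsometryEquiv.refl ℝ E4) 1 0 (by simp)
  have hfam : (fun n => (junk n).comp (linActMulti (LinearIsometryEquiv.refl ℝ E4))) = junk := by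
    funext n
    rw [linActMulti_refl, ContinuousLinearMap.comp_id]
  rwa [hfam] at h

/-- … and so does its pull-back by the quarter-turn frame. -/
theorem sandwichRows_junk_quarterTurn {R : E4 ≃ₗᵢ[ℝ] E4} (hR : IsQuarterTurnFrame R) :
    SandwichRows (fun n => (junk n).comp (linActMulti R)) :=
  sandwichRows_junk_frame R _ _ hR.apply_single_zero

/-! ## §4 The model-blind core and the junk family -/

/-- **The model-blind core of Σ**: every clause about `S₁` alone (OS package, translations, proper hypercubic
invariance, continuum gap, eight frames, cone, soft kernel); no gauge group, scheme, tie or lattice gap. -/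
def SandwichModelBlind : Prop :=
  ∀ (S₁ : SchwingerFamily E4), OSPackage S₁ → Translations S₁ → Hypercubic S₁ →
    (∃ Δ : ℝ, 0 < Δ ∧ S₁.toLabelled.HasMassGap Δ) → EightFrameRP S₁ → PlanarCone S₁ → SoftKernel S₁ →
      SandwichRows S₁ ∧ ∀ R : E4 ≃ₗᵢ[ℝ] E4, IsQuarterTurnFrame R → SandwichRows (fun n => (S₁ n).comp (linActMulti R))

/-- **§4a. The model-blind core implies the crux** (so a proof of Σ that never reads the lattice is a proof of
`SandwichModelBlind`; whether that core is TRUE is open — see the work file: no tree family refutes it, and on paper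
it holds throughout the quasi-free class with a soft kernel, `μ = Δ₂ − 1 < 4`). -/
theorem curvatureSandwichBound_of_modelBlind (hMB : SandwichModelBlind) :
    Summit.QuantumFields.YangMills.Theses.IsotropyFromPowerCounting.CurvatureSandwichBound := by
  rw [curvatureSandwichBound_iff]
  intro G _ _ _ _ _ _ _ r sch S₁ hW h8 hC hK
  exact hMB S₁ hW.2.1 hW.2.2.1 hW.2.2.2.1 (hW.2.2.2.2.imp fun Δ hΔ => ⟨hΔ.1, hΔ.2.1⟩) h8 hC hK

/-- **§4b. The junk family meets the CONCLUSION of the model-blind core** (both rows, `μ = 0`, `C = 0`) — although it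
meets every one of its hypotheses too (`junk_hypotheses_softWithoutTieAt4`: OS package, translations, hypercubic,
gap, eight frames, cone, soft kernel).  So the witness that refutes the model-blind cores of
`CurvatureBoostCovariance`, `SoftKernelBoostCovariance`, `TemperedCurvatureMoments` and `NPointIsotropy` in Lean is
blind to Σ: singular-support families have vacuum-only OS spaces. -/
theorem modelBlind_conclusion_junk :
    SandwichRows junk ∧ ∀ R : E4 ≃ₗᵢ[ℝ] E4, IsQuarterTurnFrame R → SandwichRows (fun n => (junk n).comp (linActMulti R)) :=
  ⟨sandwichRows_junk, fun _ hR => sandwichRows_junk_quarterTurn hR⟩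

end Summit.QuantumFields.YangMills.Theorems.CurvatureSandwichBound.Negative

end
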